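import Summits.QuantumFields.YangMills.Theorems.UnitScaleTiltFluctuationComparisonRegPrPrintChi
import Literature.MathematicalPhysics.QuantumFieldTheory.Balaban1983to89.T3Prop1EmlAtHolds
import Literature.MathematicalPhysics.QuantumFieldTheory.Balaban1983to89.T3ThresholdSmallness
import HarnessLib

/-!
# `UnitScaleTiltFluctuationComparisonRegPrPrintChiTransfer` — STUB 4′ of crux `FluctuationComparisonRegPrL` (stmt-QuantumFields-19935), repair (R1) «print's χ
# of [Balaban1985UV3] (47) back», part 5: PRINT'S `χ_k` ⊆ `ChiGood` UNCONDITIONALLY — the averaging-regularity row of the transfer lemma is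
# [Balaban1985Averaging] Prop. 2 (52)–(54), PROVED in the tree for the cell's averaging (`BlockAveragingEMLProp2.plaqSmall_iter_blockAvg_eml_level`)

Cell `ym3-torus`, width-lever lane `ym-ust-19935-r1`; sibling of `…PrintChi` (p528527).  Count-neutral helper (`--supports stmt-QuantumFields-19935`).  CORRECTION of
`…PrintChi` §3's «LOCATED» sentence: the `j`-uniform factor `a = 2` in «the minimiser's `j`-fold averages have plaquette variables `< a·L^{2j}·θBal(n)·L^{−2(K−n)}`» is
NOT a property of minimisers — it is [Balaban1985Averaging] Prop. 2 (53), valid for EVERY field with `|U(∂p) − 1| < α₀η²` once `α₀` is below print's constants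
(`C₀α₀ ≤ ⅓`, `2α₀ ≤ c′₂ = 2δ₂/(7L)²` in d = 3), and the tree proves it for the (0.4)/`exp[mean log]` averaging of record (lit pointer L-25 (d), ym3-torus-lit g14).  Hence:

* `chiGood_of_printChi_sharp` — print's `χ_k(V) = 1` («|U_k(∂p) − 1| < g_k p(g_k)η²» for the regular minimiser `U_k` of `V`, (47) p.267) ⇒ `ChiGood F γ b₀ p₀ ε₀ μ h V` for
  every margin with `2 ≤ (1 − μ)·L√L`, provided `θBal(n)` is below print's two constants — NO further hypothesis.  At `L = 3`: `μ₃ = 1 − 2/√27 ≈ 0.615`.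
* `exists_coupling_chiGood_of_printChi` — the smallness holds at EVERY height below a coupling threshold `γ₁(L, b₀, p₀)` (`T3ThresholdSmallness.exists_forall_θBal_le`): for
  `0 < γ ≤ γ₁`, print's `χ` puts the datum in `ChiGood` with margin `1 − 2/(L√L)` at every run, height and datum.

So at every block size the χ-good set of `…PrintChi` CONTAINS print's `χ_k`-set, on which (47) is printed; what the sharp-window reading of FINDING #44 misses is
exactly the data in `Win ∖ χ`.  Pure bookkeeping over tree theorems; nothing of [Balaban1985UV3] is asserted; no numerics.

References: T. Bałaban, CMP 98 (1985) 17–51 [Balaban1985Averaging] (Prop. 2 (52)–(54) p.26); CMP 102 (1985) 255–275 [Balaban1985UV3] ((47) p.267, p.267 l.1–4).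
-/

noncomputable section

namespace Summit.QuantumFields.YangMills.Theorems.PrintChi

open MeasureTheory Filter
open Literature.MathematicalPhysics.QuantumFieldTheory.Balaban1983to89
open Literature.MathematicalPhysics.QuantumFieldTheory.Balaban1983to89.T3ContinuumYM3Torus
open Literature.MathematicalPhysics.QuantumFieldTheory.Balaban1983to89.T3UnitLawDensityEML (ℰp measurableE_ℰp)
open Literature.MathematicalPhysics.QuantumFieldTheory.Balaban1983to89.T3UnitScaleTilt
open Literature.MathematicalPhysics.QuantumFieldTheory.Balaban1983to89.T3RegularMinimiser
open Literature.MathematicalPhysics.QuantumFieldTheory.Balaban1983to89.T3PrintedRegularMinimiser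
open Literature.MathematicalPhysics.QuantumFieldTheory.Balaban1983to89.T3ThresholdSmallness
open Literature.MathematicalPhysics.QuantumFieldTheory.Balaban1983to89.ExpMeanLog (deltaSU deltaSU_pos)
open Literature.MathematicalPhysics.QuantumFieldTheory.Balaban1983to89.BlockAveragingEMLProp2 (plaqSmall_iter_blockAvg_eml_level)
open Literature.MathematicalPhysics.QuantumFieldTheory.Balaban1983to89.Missing

section Transfer

variable {F : T3Family} {γ b₀ p₀ ε₀ μ : ℝ}

/-- Weakening a plaquette bound (local helper). [folklore] -/
private theorem plaqSmall_of_le'' {P : Params} {j : ℕ} {G : Type*} [GaugeGroup G] {δ δ' : ℝ} (hδ : δ ≤ δ')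
    {U : GaugeField P j G} (hU : PlaqSmall δ U) : PlaqSmall δ' U :=
  fun p => (hU p).trans_le hδ

/-- **PRINT'S `χ_k` ⊆ `ChiGood`, UNCONDITIONALLY.**  If the regular minimiser `U` of the datum `V` (height `n`, run `K`) satisfies print's lower-bound condition
`|U(∂p) − 1| < θBal(n)·L^{−2(K−n)}` at every finest plaquette ((47): «χ_k corresponds to the restrictions on V given by the conditions |U_k(∂p) − 1| < g_k p(g_k)η²»),
and `θBal(n)` is below print's averaging constants (`C₀θBal(n) ≤ ⅓`, `2θBal(n) ≤ 2δ₂/(7L)²`, `C₀ = 143·(49/4)²`), then `V` is χ-good with every margin `μ` such that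
`2 ≤ (1 − μ)·L√L`: [Balaban1985Averaging] Prop. 2 (53) (tree `plaqSmall_iter_blockAvg_eml_level`) bounds the `j`-fold averages by `2θBal(n)·L^{2j}·L^{−2(K−n)}`, and
`…PrintChi.chiGood_of_printChi` does the rest (`L⁻²` per level against the window ratio `L^{−1/2}`).  L = 3: `μ = 1 − 2/√27`. [cite: Balaban1985Averaging, Prop. 2 (52)–(54) p.26] -/
theorem chiGood_of_printChi_sharp (hγ : 0 < γ) (hγ1 : γ ≤ 1) (hb : 0 < b₀) (hp : 0 ≤ p₀) {n K : ℕ} (h : n ≤ K)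
    {V : GaugeField (F.P n) 0 (Matrix.specialUnitaryGroup (Fin 2) ℂ)} {U : GaugeField (F.P K) 0 (Matrix.specialUnitaryGroup (Fin 2) ℂ)}
    (hU : U ∈ regFibrePr F n K h ε₀ V) (hmin : wilsonAction4 U = minActionRegPr F n K h ε₀ V)
    (hχ : PlaqSmall (θBal F.L γ b₀ p₀ n * ((F.L : ℝ)⁻¹) ^ (2 * (K - n))) U)
    (hθ3 : (143 * ((((3 + 4 : ℕ) : ℝ)) ^ 2 / 4) ^ 2) * θBal F.L γ b₀ p₀ n ≤ 1 / 3)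
    (hθ2 : 2 * θBal F.L γ b₀ p₀ n ≤ 2 * deltaSU (Fin 2) / (((3 + 4) * F.L : ℕ) : ℝ) ^ 2)
    (hμ : 2 ≤ (1 - μ) * ((F.L : ℝ) * Real.sqrt F.L)) :
    ChiGood F γ b₀ p₀ ε₀ μ h V := by
  have hL : 1 ≤ F.L := F.hL.2.le
  have hL0 : (0 : ℝ) < F.L := by exact_mod_cast (show 0 < F.L by omega)
  have hθ : 0 < θBal F.L γ b₀ p₀ n := T3MinimiserStabilityReduction.θBal_pos hL hγ hγ1 hb p₀ n
  refine chiGood_of_printChi hγ hγ1 hb hp h hU hmin (a := 2) (by norm_num) hμ fun j hj => ?_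
  -- (52) in the torus's letters: `θBal(n)·((L^{K−n})⁻¹)²`
  have h52 : PlaqSmall (θBal F.L γ b₀ p₀ n * ((((F.P K).L : ℝ) ^ (K - n))⁻¹) ^ 2) U := by
    refine plaqSmall_of_le'' (le_of_eq ?_) hχ
    show θBal F.L γ b₀ p₀ n * ((F.L : ℝ)⁻¹) ^ (2 * (K - n)) = θBal F.L γ b₀ p₀ n * ((((F.L : ℝ)) ^ (K - n))⁻¹) ^ 2
    rw [← inv_pow, ← pow_mul, mul_comm (K - n) 2]
  have hlev := plaqSmall_iter_blockAvg_eml_level (P := F.P K) (n := Fin 2) (K - n) hθ hθ3 hθ2 h52 (j := j) (by omega)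
  refine plaqSmall_of_le'' (le_of_eq ?_) hlev
  show 2 * θBal F.L γ b₀ p₀ n * ((F.L : ℝ) ^ j * ((F.L : ℝ) ^ (K - n))⁻¹) ^ 2 =
    2 * (F.L : ℝ) ^ (2 * j) * (θBal F.L γ b₀ p₀ n * ((F.L : ℝ)⁻¹) ^ (2 * (K - n)))
  rw [← inv_pow, mul_pow, ← pow_mul, ← pow_mul, mul_comm j 2, mul_comm (K - n) 2]
  ring

/-- **BELOW A COUPLING THRESHOLD, PRINT'S `χ` TRANSFERS AT EVERY RUN, HEIGHT AND DATUM** with the block-size margin `μ_L = 1 − 2/(L√L)` (`> 0` for `L ≥ 2`): the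
two smallness conditions on `θBal(n)` hold uniformly in `n` once `γ ≤ γ₁(L, b₀, p₀)` (`T3ThresholdSmallness.exists_forall_θBal_le`). [cite: Balaban1985Averaging, Prop. 2 (52)–(54) p.26] -/
theorem exists_coupling_chiGood_of_printChi (F : T3Family) (hb : 0 < b₀) (hp : 0 ≤ p₀) (ε₀ : ℝ) :
    ∃ γ₁ : ℝ, 0 < γ₁ ∧ ∀ γ : ℝ, 0 < γ → γ ≤ γ₁ → ∀ {n K : ℕ} (h : n ≤ K)
      (V : GaugeField (F.P n) 0 (Matrix.specialUnitaryGroup (Fin 2) ℂ)) (U : GaugeField (F.P K) 0 (Matrix.specialUnitaryGroup (Fin 2) ℂ)),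
      U ∈ regFibrePr F n K h ε₀ V → wilsonAction4 U = minActionRegPr F n K h ε₀ V →
      PlaqSmall (θBal F.L γ b₀ p₀ n * ((F.L : ℝ)⁻¹) ^ (2 * (K - n))) U →
        ChiGood F γ b₀ p₀ ε₀ (1 - 2 / ((F.L : ℝ) * Real.sqrt F.L)) h V := by
  have hL : 1 ≤ F.L := F.hL.2.le
  have hL0 : (0 : ℝ) < F.L := by exact_mod_cast (show 0 < F.L by omega)
  have hLs : 0 < (F.L : ℝ) * Real.sqrt F.L := by positivity
  -- the smaller of print's two constants
  set c : ℝ := min (1 / 3 / (143 * ((((3 + 4 : ℕ) : ℝ)) ^ 2 / 4) ^ 2)) (deltaSU (Fin 2) / (((3 + 4) * F.L : ℕ) : ℝ) ^ 2) with hc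
  have hC₀ : (0 : ℝ) < 143 * ((((3 + 4 : ℕ) : ℝ)) ^ 2 / 4) ^ 2 := by positivity
  have h7L : (0 : ℝ) < (((3 + 4) * F.L : ℕ) : ℝ) ^ 2 := by
    have : 0 < (3 + 4) * F.L := by omega
    positivity
  have hcpos : 0 < c := lt_min (div_pos (by norm_num) hC₀) (div_pos deltaSU_pos h7L)
  obtain ⟨γ₀, hγ₀, hsmall⟩ := exists_forall_θBal_le hL b₀ p₀ hcpos
  refine ⟨min γ₀ 1, lt_min hγ₀ one_pos, fun γ hγ hγle n K h V U hU hmin hχ => ?_⟩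
  have hγ1 : γ ≤ 1 := hγle.trans (min_le_right _ _)
  have hθc : θBal F.L γ b₀ p₀ n ≤ c := hsmall γ hγ (hγle.trans (min_le_left _ _)) n
  refine chiGood_of_printChi_sharp hγ hγ1 hb hp h hU hmin hχ ?_ ?_ (le_of_eq ?_)
  · have h1 : θBal F.L γ b₀ p₀ n ≤ 1 / 3 / (143 * ((((3 + 4 : ℕ) : ℝ)) ^ 2 / 4) ^ 2) := hθc.trans (min_le_left _ _)
    rwa [le_div_iff₀ hC₀, mul_comm] at h1
  · have h2 : θBal F.L γ b₀ p₀ n ≤ deltaSU (Fin 2) / (((3 + 4) * F.L : ℕ) : ℝ) ^ 2 := hθc.trans (min_le_right _ _)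
    rw [mul_div_assoc]
    linarith
  · field_simp
    ring

end Transfer

end Summit.QuantumFields.YangMills.Theorems.PrintChi

end
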